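import Summits.Ventures.PercRepro.C026HubC
import Summits.Ventures.PercRepro.C026HubFamilyExt

/-!
# C-026 when the neighbourhood of `c` is hub-like, I: hub-like vertices and the `bot` structure (p5, gen 9)

mine-3's **Theorem′** (`proofs/MINE3-HUB-theorem.md`, «Extension»): C-026 holds at every `p` on every
marked multigraph in which every non-mark neighbour of `c` is **hub-like** — adjacent only to the
marks — while the rest of the graph (everything around `a` and `b`) is arbitrary.  The family is
p1's `IsMarkHubGraph a b c c` (`C026HubFamilyExt.lean`), closed under marked minors, so by p1's
`c026_cHub_of_reduced` it suffices to prove the **reduced class positivity** on the family: on a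
SIMPLE member with distinct marks, `#Bot₃ ≤ #(ac|b) + #(bc|a)` (`cubeSumQuad_kernel26_nonneg_iff`,
`C026Class.lean`).  The three files `C026CHubA` / `C026CHubB` / `C026CHub` re-run the injection of
`C026HubB.lean` / `C026HubC.lean` with the clusters `K`, `L` of `a`, `b` ARBITRARY.

This file: a hub-like vertex is joined to the rest of the graph through its open mark edge only
(`IsHubLike.conn_iff`, `IsBot.conn_mark_hubLike_iff`, `IsHubLike.eq_of_conn_of_noOpen`); in a `bot`
configuration the cluster `M` of `c` is still the star `{c} ∪ {c-hubs with open c-edge}`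
(`IsBot.conn_c_iff`); the cut tree `δ(ω) = ω Δ (E[M] ∪ (E[L] ∖ E[K]))` opens exactly the same edges
at `c`'s neighbourhood as on a hub graph (`IsBot.cutSwap_link_ha'`, `IsBot.cutSwap_link_hb'`), and
every δ-open edge leaving `K` enters `M` (`IsBot.conn_c_of_cutSwap_open`).  The three cases of
`Bot₃` are in `C026CHubB.lean`, the injections and the theorem in `C026CHub.lean`.
-/

namespace PercRepro

namespace MultiGraph

variable {V E : Type*} {G : MultiGraph V E}

/-! ### Hub-like vertices -/

section HubLike

variable {a b c : V}

/-- In the family `IsMarkHubGraph a b c c`, a non-mark with an edge to `c` is hub-like. -/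
theorem IsMarkHubGraph.isHubLike_of_link (hG : G.IsMarkHubGraph a b c c) {h : V}
    (hh : IsHubV a b c h) {e : E} (hl : G.Link e h c) : G.IsHubLike a b c h := by
  have hm : ¬ IsMark a b c h := fun hm => by
    rcases hm with hm | hm | hm
    · exact hh.1 hm
    · exact hh.2.1 hm
    · exact hh.2.2 hm
  rcases hl with ⟨h1, h2⟩ | ⟨h1, h2⟩
  · have := (hG e).2 h2 (by rw [h1]; exact hm)
    rwa [h1] at this
  · have := (hG e).1 h1 (by rw [h2]; exact hm)
    rwa [h2] at this

/-- The other endpoint of an edge at a hub-like vertex is a mark. -/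
theorem IsHubLike.mark_of_link {x : V} (hx : G.IsHubLike a b c x) {e : E} {y : V}
    (hl : G.Link e x y) : y = a ∨ y = b ∨ y = c := by
  rcases hl with ⟨h1, h2⟩ | ⟨h1, h2⟩
  · have := (hx e).1 h1
    rwa [h2] at this
  · have := (hx e).2 h2
    rwa [h1] at this

/-- **Paths out of a hub-like vertex pass through a mark**: a vertex connected to a hub-like `x` is
`x` itself, or is connected to a mark `m` joined to `x` by an open edge. -/
theorem IsHubLike.conn_iff {x : V} (hx : G.IsHubLike a b c x) {ω : Config E} {y : V} :
    G.Conn ω x y ↔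
      y = x ∨ ∃ m, (m = a ∨ m = b ∨ m = c) ∧ G.OpenTo ω x m ∧ G.Conn ω m y := by
  constructor
  · intro hxy
    refine Conn.induction (motive := fun y => y = x ∨
      ∃ m, (m = a ∨ m = b ∨ m = c) ∧ G.OpenTo ω x m ∧ G.Conn ω m y) (Or.inl rfl) ?_ hxy
    intro z z' _ hzz' ih
    obtain ⟨f, hf, hend⟩ := hzz'
    have hl : G.Link f z z' := hend
    rcases ih with hzx | ⟨m, hm, hxm, hmz⟩
    · right
      rw [hzx] at hl
      exact ⟨z', hx.mark_of_link hl, ⟨f, hf, hl⟩, Conn.refl G ω z'⟩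
    · right
      exact ⟨m, hm, hxm, hmz.trans (hl.conn hf)⟩
  · rintro (rfl | ⟨m, -, hxm, hmy⟩)
    · exact Conn.refl G ω y
    · exact hxm.conn.trans hmy

/-- An isolated hub-like vertex (no open edge to any mark) is connected to nothing else. -/
theorem IsHubLike.eq_of_conn_of_noOpen {x : V} (hx : G.IsHubLike a b c x) {ω : Config E}
    (hno : G.NoOpen ω a b c x) {y : V} (h : G.Conn ω x y) : y = x := by
  rcases hx.conn_iff.1 h with h | ⟨m, hm, hxm, -⟩
  · exact h
  · exfalso
    rcases hm with rfl | rfl | rfl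
    · exact hno.1 hxm
    · exact hno.2.1 hxm
    · exact hno.2.2 hxm

end HubLike

/-! ### `bot` configurations when the neighbourhood of `c` is hub-like -/

section Bot

variable {a b c : V} {ω : Config E}

/-- In `bot`, two connected marks coincide. -/
theorem IsBot.eq_of_conn_marks (hbot : G.IsBot ω a b c) {m m' : V}
    (hm : m = a ∨ m = b ∨ m = c) (hm' : m' = a ∨ m' = b ∨ m' = c) (h : G.Conn ω m m') :
    m = m' := by
  obtain ⟨h1, h2, h3⟩ := hbot
  rcases hm with rfl | rfl | rfl <;> rcases hm' with rfl | rfl | rfl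
  · rfl
  · exact (h1 h).elim
  · exact (h2 h).elim
  · exact (h1 h.symm).elim
  · rfl
  · exact (h3 h).elim
  · exact (h2 h.symm).elim
  · exact (h3 h.symm).elim
  · rfl

/-- In `bot`, a mark is connected to a hub-like non-mark iff the vertex has an open edge to it. -/
theorem IsBot.conn_mark_hubLike_iff (hbot : G.IsBot ω a b c) {x : V} (hx : G.IsHubLike a b c x)
    (hh : IsHubV a b c x) {m : V} (hm : m = a ∨ m = b ∨ m = c) :
    G.Conn ω m x ↔ G.OpenTo ω x m := by
  constructor
  · intro hmx
    rcases hx.conn_iff.1 hmx.symm with h | ⟨m', hm', hxm', hm'm⟩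
    · exfalso
      rcases hm with rfl | rfl | rfl
      · exact hh.1 h.symm
      · exact hh.2.1 h.symm
      · exact hh.2.2 h.symm
    · rw [hbot.eq_of_conn_marks hm' hm hm'm] at hxm'
      exact hxm'
  · intro h
    exact h.conn.symm

/-- **The cluster of `c` in `bot` is a star**: `c` and the `c`-hubs whose open edge goes to `c`. -/
theorem IsBot.conn_c_iff (hG : G.IsMarkHubGraph a b c c) (hs : G.IsSimple) (hac : a ≠ c)
    (hbc : b ≠ c) (hbot : G.IsBot ω a b c) (y : V) :
    G.Conn ω c y ↔ y = c ∨ (IsHubV a b c y ∧ G.OpenTo ω y c) := by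
  constructor
  · intro hcy
    refine Conn.induction (motive := fun y => y = c ∨ (IsHubV a b c y ∧ G.OpenTo ω y c))
      (Or.inl rfl) ?_ hcy
    intro z z' _ hzz' ih
    obtain ⟨f, hf, hend⟩ := hzz'
    have hl : G.Link f z z' := hend
    rcases ih with hzc | ⟨hz, hzc⟩
    · -- an open edge at `c`: its other endpoint is no mark (`bot`, simple), hence a `c`-hub
      right
      rw [hzc] at hl
      have hne : z' ≠ c := by
        rintro rfl
        exact hs.1 f (by rcases hl with ⟨h1, h2⟩ | ⟨h1, h2⟩ <;> rw [h1, h2])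
      have hz'a : z' ≠ a := by
        rintro rfl
        exact hbot.not_openTo_marks (Or.inr (Or.inr rfl)) (Or.inl rfl) hac.symm ⟨f, hf, hl⟩
      have hz'b : z' ≠ b := by
        rintro rfl
        exact hbot.not_openTo_marks (Or.inr (Or.inr rfl)) (Or.inr (Or.inl rfl)) hbc.symm
          ⟨f, hf, hl⟩
      exact ⟨⟨hz'a, hz'b, hne⟩, ⟨f, hf, hl.symm⟩⟩
    · -- an open edge at a `c`-hub of `M`: its other endpoint is a mark, and only `c` is possible
      have hhub : G.IsHubLike a b c z := by
        obtain ⟨g, -, hg⟩ := hzc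
        exact hG.isHubLike_of_link hz hg
      rcases hhub.mark_of_link hl with rfl | rfl | rfl
      · exact (hbot.openTo_unique (Or.inl rfl) (Or.inr (Or.inr rfl)) hac ⟨f, hf, hl⟩ hzc).elim
      · exact (hbot.openTo_unique (Or.inr (Or.inl rfl)) (Or.inr (Or.inr rfl)) hbc ⟨f, hf, hl⟩
          hzc).elim
      · exact Or.inl rfl
  · rintro (rfl | ⟨-, h⟩)
    · exact Conn.refl G ω y
    · exact h.conn.symm

/-- **A δ-open edge leaving the cluster of `a` enters the cluster of `c`**: it is closed in `ω`,
hence flipped, hence at `M` (it is at `K`, so not in `E[L] ∖ E[K]`). -/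
theorem IsBot.conn_c_of_cutSwap_open (hbot : G.IsBot ω a b c) {e : E} {x y : V}
    (hl : G.Link e x y) (hx : G.Conn ω a x) (hy : ¬ G.Conn ω a y)
    (he : G.cutSwap a b c ω e = true) : G.Conn ω c y := by
  have h0 : ω e = false := by
    cases h : ω e
    · rfl
    · exact absurd (hx.trans (hl.conn h)) hy
  have hmem : e ∈ G.swapSetC ω a b c := by
    by_contra hmem
    rw [G.cutSwap_apply_of_notMem hmem, h0] at he
    exact Bool.noConfusion he
  rw [mem_swapSetC, hl.mem_edgesAt_iff, hl.mem_edgesAt_iff, hl.mem_edgesAt_iff] at hmem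
  simp only [mem_cluster] at hmem
  rcases hmem with (h | h) | ⟨-, h⟩
  · exact absurd (hx.trans h.symm) hbot.2.1
  · exact h
  · exact absurd (Or.inl hx) h

/-- **The `a`-edge of a `c`-hub in `δ(ω)`** (the cluster `K` of `a` arbitrary): open iff the hub's
open edge goes to `a` or to `c`. -/
theorem IsBot.cutSwap_link_ha' (hG : G.IsMarkHubGraph a b c c) (hs : G.IsSimple) (hac : a ≠ c)
    (hbc : b ≠ c) (hbot : G.IsBot ω a b c) {e : E} {h : V} (hh : IsHubV a b c h)
    (hl : G.Link e h a) :
    G.cutSwap a b c ω e = true ↔ G.OpenTo ω h a ∨ G.OpenTo ω h c := by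
  have hmem : e ∈ G.swapSetC ω a b c ↔ G.OpenTo ω h c := by
    rw [mem_swapSetC, hl.mem_edgesAt_iff, hl.mem_edgesAt_iff, hl.mem_edgesAt_iff]
    simp only [mem_cluster]
    rw [hbot.conn_c_iff hG hs hac hbc h]
    constructor
    · rintro ((h' | h') | ⟨-, h'⟩)
      · rcases h' with h' | ⟨-, h'⟩
        · exact absurd h' hh.2.2
        · exact h'
      · exact absurd h'.symm hbot.2.1
      · exact absurd (Or.inr (Conn.refl G ω a)) h'
    · intro h'
      exact Or.inl (Or.inl (Or.inr ⟨hh, h'⟩))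
  have hω : ω e = true ↔ G.OpenTo ω h a := (openTo_iff_of_link hs hl ω).symm
  have hex : ¬ (G.OpenTo ω h a ∧ G.OpenTo ω h c) := fun ⟨h1, h2⟩ =>
    hbot.openTo_unique (Or.inl rfl) (Or.inr (Or.inr rfl)) hac h1 h2
  by_cases hc : G.OpenTo ω h c
  · rw [G.cutSwap_apply_of_mem (hmem.2 hc)]
    have h0 : ω e = false := by
      cases he : ω e
      · rfl
      · exact absurd ⟨hω.1 he, hc⟩ hex
    rw [h0]
    simp [hc]
  · rw [G.cutSwap_apply_of_notMem (fun h' => hc (hmem.1 h')), hω]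
    simp [hc]

/-- **The `b`-edge of a `c`-hub in `δ(ω)`** (the clusters `K`, `L` arbitrary): open iff the hub's
open edge goes to `c`, or the hub has no open edge at all. -/
theorem IsBot.cutSwap_link_hb' (hG : G.IsMarkHubGraph a b c c) (hs : G.IsSimple) (hab : a ≠ b)
    (hac : a ≠ c) (hbc : b ≠ c) (hbot : G.IsBot ω a b c) {e : E} {h : V} (hh : IsHubV a b c h)
    (hx : G.IsHubLike a b c h) (hl : G.Link e h b) :
    G.cutSwap a b c ω e = true ↔
      G.OpenTo ω h c ∨ (¬ G.OpenTo ω h a ∧ ¬ G.OpenTo ω h b ∧ ¬ G.OpenTo ω h c) := by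
  have hmem : e ∈ G.swapSetC ω a b c ↔ G.OpenTo ω h c ∨ ¬ G.OpenTo ω h a := by
    rw [mem_swapSetC, hl.mem_edgesAt_iff, hl.mem_edgesAt_iff, hl.mem_edgesAt_iff]
    simp only [mem_cluster]
    rw [hbot.conn_c_iff hG hs hac hbc h, hbot.conn_mark_hubLike_iff hx hh (Or.inl rfl)]
    constructor
    · rintro ((h' | h') | ⟨-, h'⟩)
      · rcases h' with h' | ⟨-, h'⟩
        · exact absurd h' hh.2.2
        · exact Or.inl h'
      · exact absurd h'.symm hbot.2.2
      · exact Or.inr fun ha => h' (Or.inl ha)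
    · rintro (h' | h')
      · exact Or.inl (Or.inl (Or.inr ⟨hh, h'⟩))
      · refine Or.inr ⟨Or.inr (Conn.refl G ω b), fun h'' => ?_⟩
        rcases h'' with h'' | h''
        · exact h' h''
        · exact hbot.1 h''
  have hω : ω e = true ↔ G.OpenTo ω h b := (openTo_iff_of_link hs hl ω).symm
  have hbc' : ¬ (G.OpenTo ω h b ∧ G.OpenTo ω h c) := fun ⟨h1, h2⟩ =>
    hbot.openTo_unique (Or.inr (Or.inl rfl)) (Or.inr (Or.inr rfl)) hbc h1 h2
  have hab' : ¬ (G.OpenTo ω h a ∧ G.OpenTo ω h b) := fun ⟨h1, h2⟩ =>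
    hbot.openTo_unique (Or.inl rfl) (Or.inr (Or.inl rfl)) hab h1 h2
  by_cases hc : G.OpenTo ω h c
  · rw [G.cutSwap_apply_of_mem (hmem.2 (Or.inl hc))]
    have h0 : ω e = false := by
      cases he : ω e
      · rfl
      · exact absurd ⟨hω.1 he, hc⟩ hbc'
    rw [h0]
    simp [hc]
  by_cases ha : G.OpenTo ω h a
  · rw [G.cutSwap_apply_of_notMem (fun h' => by
      rcases hmem.1 h' with h' | h'
      · exact hc h'
      · exact h' ha)]
    have h0 : ω e = false := by
      cases he : ω e
      · rfl
      · exact absurd ⟨ha, hω.1 he⟩ hab'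
    rw [h0]
    simp [hc, ha]
  · rw [G.cutSwap_apply_of_mem (hmem.2 (Or.inr ha))]
    constructor
    · intro h'
      refine Or.inr ⟨ha, ?_, hc⟩
      rw [← hω]
      simpa using h'
    · rintro (h' | ⟨-, h', -⟩)
      · exact absurd h' hc
      · rw [← hω] at h'
        simpa using h'

end Bot

end MultiGraph

end PercRepro
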